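import Summits.RiemannHypothesis.RiemannHypothesis.Theorems.WeilFormatCDataLog3HalfTables
import HarnessLib

/-!
# Format C kernel rung `Log3Half` (a = (log 3)/2): validity of the constants, prime data and the full table (kernel certificates)

Window `a = (log 3)/2`; prime powers in the window: 2; evaluator parameters S = 2^80, Kpi 70, Kser 96, kred 8, Kexp 24, J 60; full table modes < 34; light column table modes < 131; units 2^-80 (entries), 2^-40 (weights).
Generated by rh-explicit-weil-2 gen5 (gen/gramgen.py + emit5.py) from `#eval` of the tree's `Encl` functions; every datum is re-verified by the kernel in the theorem files (`decide +kernel`: recompute + containment). Helper data of the rh-explicit Weil-positivity programme (format C, K-CELL-2 CAL rung), RH-free. [cite: Yoshida1992HermitianForms, §5 (5.15)-(5.16) p. 301; §7 pp. 305–312]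
-/

set_option linter.dupNamespace false
set_option maxRecDepth 200000

namespace Summit.RiemannHypothesis.RiemannHypothesis.Theorems.WeilFormatCData.Log3Half
open Literature.NumberTheory.LFunctions Literature.NumberTheory.LFunctions.Yoshida1992 Encl Literature.Analysis.ValidatedNumerics.NumericsMP

/-- kernel: `P ∋ π`. -/
theorem tP : checkPi (2 ^ 80) 70 P = true := by decide +kernel

/-- kernel: `A ∋ a`. -/
theorem tA : checkHalfLogNat (2 ^ 80) 96 3 A = true := by decide +kernel

/-- kernel: the constants record is valid. -/
theorem tC : checkConsts prm P A ks C = true := by decide +kernel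

/-- kernel: the prime data of the window. -/
theorem tK : checkPrimeDataHalfLog 3 ks = true := by decide +kernel

/-- `π ∈ P`. -/
theorem pi_mem : MI.mem (2 ^ 80) Real.pi P := mem_pi_of_checkPi (by norm_num) tP

/-- `a ∈ A`. -/
theorem a_mem : MI.mem (2 ^ 80) a A := by
  unfold a
  exact mem_of_checkHalfLogNat (S := 2 ^ 80) (by norm_num) tA

/-- `0 < a` (window written out; `a` unfolds to it). -/
theorem a_pos : (0 : ℝ) < (Real.log 3 / 2) := by
  have : (1 : ℝ) < 3 := by norm_num
  positivity

/-- the constants are valid for `a`. -/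
theorem consts_valid : ConstsValid (2 ^ 80) a ks C :=
  constsValid_of_checkConsts (prm := prm) (by norm_num [prm]) (by norm_num [prm]) pi_mem a_mem tC

/-- the prime data is valid for `a`. -/
theorem primeData : PrimeData a ks := by
  have h := primeData_of_checkHalfLog tK
  unfold a; exact_mod_cast h

/-- kernel: table slice `[0, 9)`. -/
theorem tT0 : checkTable prm C tab 0 9 = true := by decide +kernel

/-- kernel: table slice `[9, 18)`. -/
theorem tT9 : checkTable prm C tab 9 9 = true := by decide +kernel

/-- kernel: table slice `[18, 27)`. -/
theorem tT18 : checkTable prm C tab 18 9 = true := by decide +kernel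

/-- kernel: table slice `[27, 34)`. -/
theorem tT27 : checkTable prm C tab 27 7 = true := by decide +kernel

/-- the special-value table is valid below `34`. -/
theorem tab_valid : TabValid (2 ^ 80) a ks 34 tab := by
  have h0 : TabValid (2 ^ 80) a ks 0 tab := TabValid.zero
  have h9 : TabValid (2 ^ 80) a ks (0 + 9) tab :=
    h0.extend fun n hn hnk ↦ idxValid_of_checkTable (prm := prm) (by norm_num [prm]) a_pos consts_valid tT0 hn hnk
  have h18 : TabValid (2 ^ 80) a ks (9 + 9) tab :=
    h9.extend fun n hn hnk ↦ idxValid_of_checkTable (prm := prm) (by norm_num [prm]) a_pos consts_valid tT9 hn hnk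
  have h27 : TabValid (2 ^ 80) a ks (18 + 9) tab :=
    h18.extend fun n hn hnk ↦ idxValid_of_checkTable (prm := prm) (by norm_num [prm]) a_pos consts_valid tT18 hn hnk
  have h34 : TabValid (2 ^ 80) a ks (27 + 7) tab :=
    h27.extend fun n hn hnk ↦ idxValid_of_checkTable (prm := prm) (by norm_num [prm]) a_pos consts_valid tT27 hn hnk
  exact h34

end Summit.RiemannHypothesis.RiemannHypothesis.Theorems.WeilFormatCData.Log3Half
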